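/-
Literature/NumberTheory/ComplexMultiplication/DegenerateCMTypesAbelianKernelsIndexTwicePrimePowers.lean — pub-hodgecm2 (COR-CM), KEPT Literature
lane lit-deligne-3 gen 66, file F66c.  THEOREMS ONLY (no `def`, no named fact, no `sorry`, no instance, no notation; D-0026 net debt 0).
HC_CM is NOT proved.
-/
import Literature.NumberTheory.ComplexMultiplication.DegenerateCMTypesAbelianKernels
import Literature.NumberTheory.ComplexMultiplication.DegenerateCMTypesAbelianPrimePower
import Literature.NumberTheory.NumberFields.VanishingSumsRootsOfUnityPrimePowers
import HarnessLib

/-!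
# Kernels of index `2p₁^{a₁+1}⋯p_k^{a_k+1}` in a finite abelian group (`p_i` pairwise distinct ODD primes, any exponents, any `k ≥ 1`), cyclic
# quotient: the characters vanish on a CM type iff the `k`-th MIXED DIFFERENCES of its coset counts along ADMISSIBLE displacements (`x_i^{p_i} ∈ H`)
# vanish — vanishing sums of roots of unity of arbitrary odd order

Topic `Literature/NumberTheory/ComplexMultiplication` (namespace `Literature.NumberTheory.ComplexMultiplication.CyclicCMType.AbelianKernels`); cell
`pub-hodgecm2` (COR-CM), KEPT Literature lane `lit-deligne-3` gen 66, file F66c — the kernel decision of the lane's ARBITRARY-ODD-PART programme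
(gen 66), for ANY finite abelian group, ANY number of distinct odd primes and ANY exponents, in the format of the tree's kernel decisions
(`…iff_of_index_two`, `…of_index_four`, `…equidistributed_of_index` (`2p^{j+1}`), the lane's `…of_index_four_mul{,_primePow}`,
`…separable_of_index_two_mul_odd_primes` (F64i), `…alternatingSum_of_index_two_mul_squarefree` (F65e, the squarefree case `a = 0` of this file)).
KERNEL ONLY: theorems; no `def`, no named fact, no instance, no notation (D-0014 ∕ D-0026 net debt `0`).  HC_CM is NOT proved here or anywhere in
the lane.

## Mathematics

T. Kubota [Kubota1965] §4 Lemma 2 reduces the rank of a CM type `S ⊂ G` (finite abelian `G ∋ ρ`) to the vanishing of the odd character sums `χ(S)`;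
grouped by kernels `H = ker χ` (`G/H` cyclic, `ρ ∉ H`) all characters of kernel `H` vanish together (tree `AbelianKernels.forall_sum_char_eq_zero_iff_exists`).
For `[G:H] = 2m`, `m = p₁^{a₁+1}⋯p_k^{a_k+1}` (pairwise distinct odd primes `p_i`), `G/H` CYCLIC (an assumption here — automatic only for squarefree
`m`), write `G/H = ⟨ρ̄⟩ × Π_i ⟨ū_i⟩ ≅ ℤ/2 × Π_i ℤ/p_i^{a_i+1}` with `χ(u_i) = μ_i` primitive of order `p_i^{a_i+1}` (`u_i = σ^{2m/p_i^{a_i+1}}` for a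
generator `σ`), and `N(c) = #(S ∩ cH)` the coset counts; since `S` is a CM type, `N(ρ̄c) = |H| − N(c)`.  Then F. Hazama's computation
[Hazama2003CyclicCM] (4.1), done with multiplicities,

  `χ(S) = Σ_x (N(Πū_i^{x_i}) − N(ρ̄Πū_i^{x_i})) Πμ_i^{x_i} = Σ_x E(x) Πμ_i^{x_i}`,  `E(x) = 2N(Πū_i^{x_i}) − |H| ∈ ℤ`,

a rational relation among the `m`-th roots of unity, and by the Rédei ∕ de Bruijn ∕ Schoenberg theorem for ARBITRARY order in the alternating-
difference form of the lane's F66b ([LamLeung2000] Thm. 2.2 with the prime-power reduction `Φ_{p^{a+1}}(x) = Φ_p(x^{p^a})`; tree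
`VanishingSumsPrimePowers.sum_mul_prod_pow_eq_zero_iff_forall_alternatingSum_eq_zero`) it vanishes iff every `k`-th mixed difference of `E` along
ADMISSIBLE displacements `d` (`p_i d_i = 0` in `ℤ/p_i^{a_i+1}`, i.e. `d_i ∈ p_i^{a_i}ℤ/p_i^{a_i+1}`) — equivalently (as `Σ_ε (−1)^{|ε|} = 0` for
`k ≥ 1`) of `N` — vanishes.  In the group, `χ(x_i) = μ_i^{d_i}` with `p_i d_i = 0` iff `x_i^{p_i} ∈ H`.  Hence
(**`sum_char_eq_zero_iff_alternatingSum_of_index_two_mul_primePowers`**):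

  `χ(S) = 0 ⟺ Σ_{ε ∈ {0,1}^k} (−1)^{|ε|} #(S ∩ g·x₁^{ε₁}⋯x_k^{ε_k}·H) = 0`  for all `g ∈ G` and all `x_i ∈ G` with `x_i^{p_i} ∈ H`

— literally the same condition as in the squarefree case F65e (there `x_i^{p_i} ∈ H` ranges over all of `⟨ū_i⟩`; here only over its `p_i`-torsion):
`k = 1`: the coset counts are EQUIDISTRIBUTED along the `p`-torsion of `G/H` (Hazama's Lemma 4.6.1, tree `…equidistributed_of_index`); `k = 2`:
additively separable along the `p₁p₂`-torsion; and the all-characters form **`forall_sum_char_eq_zero_iff_alternatingSum_of_index_two_mul_primePowers`**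
(the kernel contributes `φ(2m) = Π p_i^{a_i}(p_i − 1)` to Kubota's defect iff so).

* §0 private helpers (suffix `_gp`): character algebra (copied privately, as in each kernel file), `char_prod_gp`, `exists_isPrimitiveRoot_family_gp`
  (`u_i = σ^{2·Π_{j≠i}p_j^{a_j+1}}`), `pow_val_add_gp`, **`coords_eq_of_value_eq_gp`** (cancellation in `μ₂·μ_{p₁^{a₁+1}}⋯μ_{p_k^{a_k+1}}`: raise to
  the power `2Π_{j≠i}p_j^{a_j+1}`, invertible modulo `p_i^{a_i+1}`), `sum_sign_eq_zero_gp` (`Σ_ε Π(±1) = Π(−1 + 1) = 0`).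
* §1 the parametrisation `Fin 2 × Π_i ℤ/p_i^{a_i+1} → G/H`, `t ↦ ρ^e Π u_i^{x_i}`, is a bijection (injective by §0, cardinality `2m = [G:H]`), so
  every value of `χ` is `(−1)^e Πμ_i^{x_i}` and `χ(S) = Σ_t N(t)·F(t)` (`Finset.sum_fiberwise_of_maps_to`) `= Σ_x E(x) Πμ_i^{x_i}`; the opposite
  fibres by the tree's `AbelianPrimePow.card_filter_neg`, `card_fibre_mul`; then F66b and the dictionary value counts ↔ coset counts (`χ(g·Π_{ε_i} x_i)
  = (−1)^e Π μ_i^{b_i + ε_i d_i}` with `χ(x_i) = μ_i^{d_i}`; admissibility `p_i d_i = 0 ⟺ x_i^{p_i} ∈ H` through `μ_i` primitive).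
* §3 the same two theorems for prime families indexed by an arbitrary finite type `ι` (`…_fintype`; transport along `Fintype.equivFin ι` with
  `Equiv.sum_comp` ∕ `Equiv.prod_comp`), and the form indexed by the prime divisors of an arbitrary odd `n > 1` with `[G:H] = 2n`
  (**`sum_char_eq_zero_iff_alternatingSum_of_index_two_mul_odd`**, `ι = ↥n.primeFactors`, `p_q = q`, `a_q + 1 = v_q(n)`,
  `Nat.factorization_prod_pow_eq_self`) — the form the rank formulas of the programme consume.

PRESEARCH (lane rule): the `k = 1` case is Hazama's Lemma 4.6.1 (tree, any prime power), who cites Schoenberg's theorem (4.6) for the ℤ-relations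
among roots of unity; the relation theorem itself is [corpus: paper:arxiv-math_9511209 = LamLeung2000, chunk p0034: Thm. 2.2 with the Rédei ∕
de Bruijn ∕ Schoenberg attributions] (typed in F65d, prime powers in F66b); the multiplicity ∕ mixed-difference form of the CM-type criterion for a
general odd part is not found as printed (corpus hybrid «degenerate CM type character sum kernel prime power», galaxy «degenerate CM type | rank of
a CM-type | index of degeneracy», all stars: 0 relevant, lane queries gen 64–66); recorded as the lane's own elementary theorem with
[Hazama2003CyclicCM] cited for the mechanism and [LamLeung2000] for the relation theorem.

HONEST REGISTER.  Unconditional and elementary; nothing about degenerate types' Hodge classes.  The `2`-part of the index is exactly `2` here and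
`G/H` is ASSUMED cyclic (for non-squarefree `m` a quotient of order `2m` need not be).  HC_CM is NOT proved and not used.

## References

* [Hazama2003CyclicCM] F. Hazama, *Hodge cycles on abelian varieties with complex multiplication by cyclic CM-fields*, J. Math. Sci. Univ. Tokyo 10
  (2003) 581–598: (4.1), Prop. 4.1, 4.3, Lemma 4.6.1 with (4.6)–(4.10), Thm. 4.8.
* [Kubota1965] T. Kubota, *On the field extension by complex multiplication*, Trans. AMS 118 (1965), §4 Lemma 2.
* [White1993SporadicCycles] S. P. White, *Sporadic cycles on CM abelian varieties*, Compositio Math. 88 (1993), §4, proof of Lemma 3 (p. 131).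
* [LamLeung2000] T. Y. Lam, K. H. Leung, *On vanishing sums of roots of unity*, J. Algebra 224 (2000), Thm. 2.2 (via the lane's F65d ∕ F66b).
* [MontgomeryVaughan2007] H. L. Montgomery, R. C. Vaughan, *Multiplicative Number Theory I*, §4.2 (characters of finite abelian groups; via the tree).

## Provenance

Cell `pub-hodgecm2` (COR-CM), KEPT Literature lane `lit-deligne-3` gen 66 (claim ABELIAN-KERNELS-INDEX-2N-GENERAL; count-neutral, own lane), file
F66c; neighbours cited by name, nothing restated: `DegenerateCMTypesAbelianKernels` (`forall_sum_char_eq_zero_iff_exists`, `exists_oddChar_ker`),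
`DegenerateCMTypesAbelianPrimePower` (`AbelianPrimePow.card_filter_neg`, `card_fibre_mul`), `NumberFields/VanishingSumsRootsOfUnityPrimePowers`
(F66b, the criterion).  The proof text is the lane's F65e (squarefree case) with families `ZMod (p_i^{a_i+1})` and admissible displacements
throughout.  The `[folklore]` helpers are private.  Theorems only; net Literature debt 0.
-/

noncomputable section

open scoped BigOperators Classical

namespace Literature.NumberTheory.ComplexMultiplication

namespace CyclicCMType

namespace AbelianKernels

open Literature.NumberTheory.NumberFields.VanishingSumsPrimePowers
  (sum_mul_prod_pow_eq_zero_iff_forall_alternatingSum_eq_zero)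

variable {G : Type*} [CommGroup G] [Fintype G] [DecidableEq G] {ρ : G} {Φ : Finset G}

/-! ## §0 Helpers -/

section Helpers

omit [Fintype G] [DecidableEq G] in
/-- `χ(gh) = χ(g)χ(h)`. [folklore] -/
private theorem char_mul_gp (χ : AddChar (Additive G) ℂ) (g h : G) :
    χ (Additive.ofMul (g * h)) = χ (Additive.ofMul g) * χ (Additive.ofMul h) := by
  rw [ofMul_mul, AddChar.map_add_eq_mul]

omit [Fintype G] [DecidableEq G] in
/-- `χ(g^e) = χ(g)^e`. [folklore] -/
private theorem char_pow_gp (χ : AddChar (Additive G) ℂ) (g : G) (e : ℕ) :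
    χ (Additive.ofMul (g ^ e)) = χ (Additive.ofMul g) ^ e := by
  rw [ofMul_pow, AddChar.map_nsmul_eq_pow]

omit [Fintype G] [DecidableEq G] in
/-- `χ(1) = 1`. [folklore] -/
private theorem char_one_gp (χ : AddChar (Additive G) ℂ) : χ (Additive.ofMul (1 : G)) = 1 := by
  rw [ofMul_one, AddChar.map_zero_eq_one]

omit [Fintype G] [DecidableEq G] in
/-- `χ(Π g_i) = Π χ(g_i)`. [folklore] -/
private theorem char_prod_gp {ι : Type*} (χ : AddChar (Additive G) ℂ) (s : Finset ι) (g : ι → G) :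
    χ (Additive.ofMul (∏ i ∈ s, g i)) = ∏ i ∈ s, χ (Additive.ofMul (g i)) := by
  induction s using Finset.induction_on with
  | empty => rw [Finset.prod_empty, Finset.prod_empty, char_one_gp]
  | insert a s ha ih => rw [Finset.prod_insert ha, Finset.prod_insert ha, char_mul_gp, ih]

omit [Fintype G] [DecidableEq G] in
/-- `χ(g) ≠ 0`. [folklore] -/
private theorem char_ne_zero_gp (χ : AddChar (Additive G) ℂ) (g : G) : χ (Additive.ofMul g) ≠ 0 := by
  intro h0
  have := char_mul_gp χ g g⁻¹
  rw [mul_inv_cancel, char_one_gp, h0, zero_mul] at this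
  exact one_ne_zero this

omit [Fintype G] [DecidableEq G] in
/-- `χ(s) = χ(g)` iff `g⁻¹s ∈ ker χ`. [folklore] -/
private theorem char_eq_iff_inv_mul_mem_gp {H : Subgroup G} (χ : AddChar (Additive G) ℂ)
    (hker : ∀ g : G, χ (Additive.ofMul g) = 1 ↔ g ∈ H) (g s : G) :
    χ (Additive.ofMul s) = χ (Additive.ofMul g) ↔ g⁻¹ * s ∈ H := by
  rw [← hker]
  have h1 : χ (Additive.ofMul (g⁻¹ * s)) * χ (Additive.ofMul g) = χ (Additive.ofMul s) := by
    rw [← char_mul_gp, mul_comm g⁻¹ s, inv_mul_cancel_right]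
  constructor
  · intro hs
    rw [hs] at h1
    exact mul_left_eq_self₀.1 h1 |>.resolve_right (char_ne_zero_gp χ g)
  · intro h
    rw [h, one_mul] at h1
    exact h1.symm

omit [Fintype G] [DecidableEq G] in
/-- `ρ² = 1` for the conjugation of a CM type. [folklore] -/
private theorem rho_mul_rho_gp (h : IsCMTypeWith ρ (Φ : Set G)) : ρ * ρ = 1 := by
  simpa [smul_eq_mul] using h.invol (1 : G)

omit [Fintype G] [DecidableEq G] in
/-- A character whose kernel misses the involution `ρ` is odd. [folklore] -/
private theorem odd_of_ker_gp {H : Subgroup G} (hρH : ρ ∉ H) (hρ2 : ρ * ρ = 1) (χ : AddChar (Additive G) ℂ)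
    (hker : ∀ g : G, χ (Additive.ofMul g) = 1 ↔ g ∈ H) : χ (Additive.ofMul ρ) = -1 := by
  have hsq : χ (Additive.ofMul ρ) * χ (Additive.ofMul ρ) = 1 := by rw [← char_mul_gp, hρ2, char_one_gp]
  rcases mul_self_eq_one_iff.1 hsq with h1 | h1
  · exact absurd ((hker ρ).1 h1) hρH
  · exact h1

omit [Fintype G] [DecidableEq G] in
/-- For `ker χ` of index `2·p₁^{a₁+1}⋯p_k^{a_k+1}` with cyclic quotient there are elements `u_i` whose `χ`-values are primitive
`p_i^{a_i+1}`-th roots of unity (`u_i = σ^{2m/p_i^{a_i+1}}` for a generator `σ` of `G/H`). [folklore] -/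
private theorem exists_isPrimitiveRoot_family_gp [Finite G] {k : ℕ} {p a : Fin k → ℕ} (hp : ∀ i, (p i).Prime) {H : Subgroup G}
    (χ : AddChar (Additive G) ℂ) (hker : ∀ g : G, χ (Additive.ofMul g) = 1 ↔ g ∈ H) (hidx : H.index = 2 * ∏ i, p i ^ (a i + 1))
    (hcyc : IsCyclic (G ⧸ H)) : ∃ u : Fin k → G, ∀ i, IsPrimitiveRoot (χ (Additive.ofMul (u i))) (p i ^ (a i + 1)) := by
  haveI := hcyc
  obtain ⟨γ, hγ⟩ := IsCyclic.exists_generator (α := G ⧸ H)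
  obtain ⟨σ, rfl⟩ := QuotientGroup.mk_surjective γ
  have hσN : orderOf (σ : G ⧸ H) = 2 * ∏ i, p i ^ (a i + 1) := by
    rw [orderOf_eq_card_of_forall_mem_zpowers hγ, ← Subgroup.index_eq_card, hidx]
  have hprim : IsPrimitiveRoot (χ (Additive.ofMul σ)) (2 * ∏ i, p i ^ (a i + 1)) := by
    rw [IsPrimitiveRoot.iff_def]
    have hk : ∀ n : ℕ, χ (Additive.ofMul σ) ^ n = 1 ↔ 2 * ∏ i, p i ^ (a i + 1) ∣ n := fun n => by
      rw [← char_pow_gp, hker, ← QuotientGroup.eq_one_iff, QuotientGroup.mk_pow, ← hσN, orderOf_dvd_iff_pow_eq_one]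
    exact ⟨(hk _).2 dvd_rfl, fun l hl => (hk l).1 hl⟩
  have hpos : 0 < 2 * ∏ i, p i ^ (a i + 1) := Nat.mul_pos two_pos (Finset.prod_pos fun i _ => pow_pos (hp i).pos _)
  refine ⟨fun i => σ ^ (2 * ∏ j ∈ Finset.univ.erase i, p j ^ (a j + 1)), fun i => ?_⟩
  rw [char_pow_gp]
  exact hprim.pow hpos (by rw [mul_assoc, Finset.prod_erase_mul _ _ (Finset.mem_univ i)])

/-- `ω^{(x + y).val} = ω^{x.val} ω^{y.val}` for `ω` a primitive `n`-th root of unity. [folklore] -/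
private theorem pow_val_add_gp {n : ℕ} [NeZero n] {ω : ℂ} (hω : IsPrimitiveRoot ω n) (x y : ZMod n) :
    ω ^ (x + y).val = ω ^ x.val * ω ^ y.val := by
  have h1 := pow_mod_orderOf ω (x.val + y.val)
  rw [← hω.eq_orderOf] at h1
  rw [ZMod.val_add, h1, pow_add]

/-- **Cancellation in `μ₂ · μ_{p₁^{a₁+1}} ⋯ μ_{p_k^{a_k+1}}`** (pairwise distinct odd primes): `(−1)^e Π μ_i^{x_i} = (−1)^{e'} Π μ_i^{x'_i}`
forces `x = x'` (raise to the power `2·Π_{j ≠ i} p_j^{a_j+1}`, which kills every factor but the `i`-th and is invertible modulo `p_i^{a_i+1}`).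
[folklore] -/
private theorem coords_eq_of_value_eq_gp {k : ℕ} {p a : Fin k → ℕ} [∀ i, NeZero (p i ^ (a i + 1))] (hp : ∀ i, (p i).Prime)
    (hinj : Function.Injective p) (hodd : ∀ i, p i ≠ 2) {μ : Fin k → ℂ} (hμ : ∀ i, IsPrimitiveRoot (μ i) (p i ^ (a i + 1)))
    {e e' : ℕ} {x x' : Π i, ZMod (p i ^ (a i + 1))}
    (h : (-1 : ℂ) ^ e * ∏ i, μ i ^ (x i).val = (-1 : ℂ) ^ e' * ∏ i, μ i ^ (x' i).val) : x = x' := by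
  funext i
  set N : ℕ := 2 * ∏ j ∈ Finset.univ.erase i, p j ^ (a j + 1) with hN
  have hkill : ∀ (f : ℕ) (y : Π i, ZMod (p i ^ (a i + 1))), ((-1 : ℂ) ^ f * ∏ j, μ j ^ (y j).val) ^ N = μ i ^ (N * (y i).val) := by
    intro f y
    have A : ((-1 : ℂ) ^ f) ^ N = 1 := by
      rw [hN, ← pow_mul, show f * (2 * ∏ j ∈ Finset.univ.erase i, p j ^ (a j + 1)) =
        2 * (f * ∏ j ∈ Finset.univ.erase i, p j ^ (a j + 1)) by ring, pow_mul, neg_one_sq, one_pow]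
    have B : (∏ j, μ j ^ (y j).val) ^ N = μ i ^ (N * (y i).val) := by
      rw [← Finset.prod_pow, Finset.prod_eq_single i]
      · rw [← pow_mul, mul_comm]
      · intro j _ hji
        have hsplit : p j ^ (a j + 1) * ∏ l ∈ (Finset.univ.erase i).erase j, p l ^ (a l + 1) =
            ∏ l ∈ Finset.univ.erase i, p l ^ (a l + 1) :=
          Finset.mul_prod_erase (Finset.univ.erase i) (fun l => p l ^ (a l + 1)) (Finset.mem_erase.2 ⟨hji, Finset.mem_univ j⟩)
        rw [← pow_mul, hN, ← hsplit, show (y j).val * (2 * (p j ^ (a j + 1) * ∏ l ∈ (Finset.univ.erase i).erase j, p l ^ (a l + 1))) =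
            p j ^ (a j + 1) * (2 * (y j).val * ∏ l ∈ (Finset.univ.erase i).erase j, p l ^ (a l + 1)) by ring, pow_mul, (hμ j).pow_eq_one,
          one_pow]
      · intro hi; exact absurd (Finset.mem_univ i) hi
    rw [mul_pow, A, B, one_mul]
  have h2 : μ i ^ (N * (x i).val) = μ i ^ (N * (x' i).val) := by rw [← hkill e x, ← hkill e' x', h]
  have hpi := hp i
  have hqi : 0 < p i ^ (a i + 1) := pow_pos hpi.pos _
  have hmod : N * (x i).val ≡ N * (x' i).val [MOD p i ^ (a i + 1)] := by
    have h1 := pow_mod_orderOf (μ i) (N * (x i).val)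
    have h1' := pow_mod_orderOf (μ i) (N * (x' i).val)
    rw [← (hμ i).eq_orderOf] at h1 h1'
    rw [← h1, ← h1'] at h2
    exact (hμ i).pow_inj (Nat.mod_lt _ hqi) (Nat.mod_lt _ hqi) h2
  have hz : ((N * (x i).val : ℕ) : ZMod (p i ^ (a i + 1))) = ((N * (x' i).val : ℕ) : ZMod (p i ^ (a i + 1))) :=
    (ZMod.natCast_eq_natCast_iff _ _ _).2 hmod
  push_cast at hz
  rw [ZMod.natCast_zmod_val, ZMod.natCast_zmod_val] at hz
  have hu : IsUnit ((N : ℕ) : ZMod (p i ^ (a i + 1))) := by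
    rw [ZMod.isUnit_iff_coprime, hN]
    refine Nat.Coprime.pow_right _ ?_
    exact Nat.Coprime.mul_left ((Nat.coprime_primes Nat.prime_two hpi).2 (Ne.symm (hodd i)))
      (Nat.Coprime.prod_left fun j hj => Nat.Coprime.pow_left _ ((Nat.coprime_primes (hp j) hpi).2
        fun hji => (Finset.mem_erase.1 hj).1 (hinj hji)))
  exact hu.mul_left_cancel hz

/-- `Σ_{ε ∈ {0,1}^k} Π_i (±1) = Π_i (−1 + 1) = 0` for `k ≥ 1`. [folklore] -/
private theorem sum_sign_eq_zero_gp {k : ℕ} (hk : 0 < k) :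
    ∑ ε : Fin k → Bool, (∏ i, (if ε i then (-1 : ℚ) else 1)) = 0 := by
  rw [← Fintype.prod_sum fun (_ : Fin k) (b : Bool) => if b then (-1 : ℚ) else 1]
  exact Finset.prod_eq_zero (Finset.mem_univ (⟨0, hk⟩ : Fin k)) (by rw [Fintype.sum_bool]; norm_num)

end Helpers

/-! ## §1 Kernels of index `2p₁^{a₁+1}⋯p_k^{a_k+1}`: the character sum over `Fin 2 × Π ℤ/p_i^{a_i+1}` and the vanishing criterion -/

section IndexTwicePrimePowers

/-- **VANISHING AT A KERNEL OF INDEX `2p₁^{a₁+1}⋯p_k^{a_k+1}` (CYCLIC QUOTIENT) IS THE VANISHING OF THE `k`-TH MIXED DIFFERENCES OF THE COSET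
COUNTS ALONG THE `p₁⋯p_k`-TORSION** (any finite abelian group `G ∋ ρ`; `p₁, …, p_k` pairwise distinct ODD primes, any exponents, `k ≥ 1`): let `χ`
be a character whose kernel `H ∌ ρ` has index `2p₁^{a₁+1}⋯p_k^{a_k+1}` and cyclic quotient, and `S` a CM type.  Then `χ(S) = 0` iff

  `Σ_{ε ∈ {0,1}^k} (−1)^{|ε|} #(S ∩ g·x₁^{ε₁}⋯x_k^{ε_k}·H) = 0`  for all `g ∈ G` and all `x_i` with `x_i^{p_i} ∈ H`,

i.e. on `G/H ≅ ℤ/2 × Π ℤ/p_i^{a_i+1}` the coset counts of `S` have vanishing `k`-th mixed differences along the displacements of order dividing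
`p_i` in the `i`-th factor (`k = 1`: EQUIDISTRIBUTED along the `p`-torsion, Hazama's Lemma 4.6.1 — tree `…equidistributed_of_index`; squarefree
odd part: the lane's F65e).  Mechanism: `χ(S) = Σ_x E(x) Π μ_i^{x_i}` with `E(x) = N(Πμ_i^{x_i}) − N(−Πμ_i^{x_i}) = 2N − |H|` (`μ_i = χ(u_i)`
primitive of order `p_i^{a_i+1}`), and the Rédei ∕ de Bruijn ∕ Schoenberg criterion for arbitrary order
`VanishingSumsPrimePowers.sum_mul_prod_pow_eq_zero_iff_forall_alternatingSum_eq_zero` (admissible displacements `p_i d_i = 0`).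
[cite: Kubota1965, §4 Lemma 2] [cite: Hazama2003CyclicCM, Prop. 4.1, Lemma 4.6.1, Thm. 4.8] [cite: LamLeung2000, Thm. 2.2] -/
theorem sum_char_eq_zero_iff_alternatingSum_of_index_two_mul_primePowers {k : ℕ} {p a : Fin k → ℕ} (hk : 0 < k)
    (hp : ∀ i, (p i).Prime) (hinj : Function.Injective p) (hodd : ∀ i, p i ≠ 2)
    (h : IsCMTypeWith ρ (Φ : Set G)) (χ : AddChar (Additive G) ℂ) {H : Subgroup G} (hρH : ρ ∉ H)
    (hker : ∀ g : G, χ (Additive.ofMul g) = 1 ↔ g ∈ H) (hidx : H.index = 2 * ∏ i, p i ^ (a i + 1)) (hcyc : IsCyclic (G ⧸ H)) :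
    ∑ s ∈ Φ, χ (Additive.ofMul s) = 0 ↔ ∀ (g : G) (x : Fin k → G), (∀ i, x i ^ p i ∈ H) →
      ∑ ε : Fin k → Bool, (∏ i, (if ε i then (-1 : ℤ) else 1)) *
        ((Φ.filter fun s => (g * ∏ i, (if ε i then x i else 1))⁻¹ * s ∈ H).card : ℤ) = 0 := by
  haveI : ∀ i, NeZero (p i ^ (a i + 1)) := fun i => ⟨pow_ne_zero _ (hp i).ne_zero⟩
  haveI : ∀ i, Fact (p i).Prime := fun i => ⟨hp i⟩
  have hρ2 := rho_mul_rho_gp h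
  have hχρ : χ (Additive.ofMul ρ) = -1 := odd_of_ker_gp hρH hρ2 χ hker
  obtain ⟨u, hu⟩ := exists_isPrimitiveRoot_family_gp hp χ hker hidx hcyc
  -- the coset counts as value counts
  have hcos : ∀ g : G, (Φ.filter fun s => g⁻¹ * s ∈ H) =
      Φ.filter fun s => χ (Additive.ofMul s) = χ (Additive.ofMul g) := fun g =>
    Finset.filter_congr fun s _ => (char_eq_iff_inv_mul_mem_gp χ hker g s).symm
  -- the values `χ(Π u_i^{x_i}) = Π μ_i^{x_i}`
  have hval : ∀ x : Π i, ZMod (p i ^ (a i + 1)), χ (Additive.ofMul (∏ i, u i ^ (x i).val)) =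
      ∏ i, χ (Additive.ofMul (u i)) ^ (x i).val := fun x => by
    rw [char_prod_gp]
    exact Finset.prod_congr rfl fun i _ => char_pow_gp χ (u i) _
  -- the fibre sizes over the values `±Π μ_i^{x_i}` are all `M := #χ⁻¹(1)`
  have hM : ∀ x : Π i, ZMod (p i ^ (a i + 1)),
      (Finset.univ.filter fun t : G => χ (Additive.ofMul t) = ∏ i, χ (Additive.ofMul (u i)) ^ (x i).val).card =
        (Finset.univ.filter fun t : G => χ (Additive.ofMul t) = 1).card := fun x => by
    rw [← hval, ← AbelianPrimePow.card_fibre_mul χ (∏ i, u i ^ (x i).val) 1, mul_one]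
  have hneg : ∀ x : Π i, ZMod (p i ^ (a i + 1)),
      (Φ.filter fun s => χ (Additive.ofMul s) = -(∏ i, χ (Additive.ofMul (u i)) ^ (x i).val)).card =
        (Finset.univ.filter fun t : G => χ (Additive.ofMul t) = 1).card -
          (Φ.filter fun s => χ (Additive.ofMul s) = ∏ i, χ (Additive.ofMul (u i)) ^ (x i).val).card := by
    intro x
    rw [AbelianPrimePow.card_filter_neg h χ hχρ, hM]
  have hle : ∀ x : Π i, ZMod (p i ^ (a i + 1)),
      (Φ.filter fun s => χ (Additive.ofMul s) = ∏ i, χ (Additive.ofMul (u i)) ^ (x i).val).card ≤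
        (Finset.univ.filter fun t : G => χ (Additive.ofMul t) = 1).card := fun x => by
    rw [← hM x]
    exact Finset.card_le_card (Finset.filter_subset_filter _ (Finset.subset_univ Φ))
  -- §A  the character sum is `Σ_x E(x) Π μ_i^{x_i}` with `E(x) = N(Πμ^x) − N(−Πμ^x)`
  set E : (Π i, ZMod (p i ^ (a i + 1))) → ℚ := fun x =>
    ((Φ.filter fun s => χ (Additive.ofMul s) = ∏ i, χ (Additive.ofMul (u i)) ^ (x i).val).card : ℚ) -
      ((Φ.filter fun s => χ (Additive.ofMul s) = -(∏ i, χ (Additive.ofMul (u i)) ^ (x i).val)).card : ℚ) with hE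
  -- the parametrisation of `G/H` by `Fin 2 × Π ℤ/p_i`
  set w : Fin 2 × (Π i, ZMod (p i ^ (a i + 1))) → G := fun t => ρ ^ (t.1 : ℕ) * ∏ i, u i ^ (t.2 i).val with hw
  set F : Fin 2 × (Π i, ZMod (p i ^ (a i + 1))) → ℂ := fun t =>
    (-1 : ℂ) ^ (t.1 : ℕ) * ∏ i, χ (Additive.ofMul (u i)) ^ (t.2 i).val with hF
  have hFw : ∀ t, χ (Additive.ofMul (w t)) = F t := fun t => by
    rw [hw, hF]
    dsimp only
    rw [char_mul_gp, char_pow_gp, hχρ, hval]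
  have hFinj : Function.Injective F := by
    rintro ⟨e, x⟩ ⟨e', x'⟩ hFF
    rw [hF] at hFF
    dsimp only at hFF
    have hx : x = x' := coords_eq_of_value_eq_gp hp hinj hodd hu hFF
    subst hx
    have hprod0 : (∏ i, χ (Additive.ofMul (u i)) ^ (x i).val) ≠ 0 :=
      Finset.prod_ne_zero_iff.2 fun i _ => pow_ne_zero _ (char_ne_zero_gp χ (u i))
    have hε : (-1 : ℂ) ^ (e : ℕ) = (-1 : ℂ) ^ (e' : ℕ) := mul_right_cancel₀ hprod0 hFF
    have hee : e = e' := by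
      by_contra hne
      have h01 : ((e : ℕ) = 0 ∧ (e' : ℕ) = 1) ∨ ((e : ℕ) = 1 ∧ (e' : ℕ) = 0) := by
        have h1 := e.isLt; have h2 := e'.isLt; have h3 : (e : ℕ) ≠ e' := fun h => hne (Fin.ext h); omega
      rcases h01 with ⟨h0, h1⟩ | ⟨h0, h1⟩ <;> rw [h0, h1] at hε <;> norm_num at hε
    rw [hee]
  have hwinj : Function.Injective (fun t => (w t : G ⧸ H)) := by
    intro t t' htt
    have hmem : (w t)⁻¹ * w t' ∈ H := QuotientGroup.eq.1 htt
    have hχeq : χ (Additive.ofMul (w t')) = χ (Additive.ofMul (w t)) := (char_eq_iff_inv_mul_mem_gp χ hker _ _).2 hmem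
    rw [hFw, hFw] at hχeq
    exact (hFinj hχeq).symm
  have hcard : Fintype.card (Fin 2 × (Π i, ZMod (p i ^ (a i + 1)))) = Fintype.card (G ⧸ H) := by
    rw [← Nat.card_eq_fintype_card (α := G ⧸ H), ← Subgroup.index_eq_card, hidx]
    simp [Fintype.card_prod, Fintype.card_pi, ZMod.card]
  have hwbij : Function.Bijective (fun t => (w t : G ⧸ H)) :=
    (Fintype.bijective_iff_injective_and_card _).2 ⟨hwinj, hcard⟩
  -- every value of `χ` is some `F t`, and the fibres of `t ↦ F t` are the value fibres
  have hexists : ∀ s : G, ∃ t, χ (Additive.ofMul s) = F t := fun s => by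
    obtain ⟨t, ht⟩ := hwbij.2 (s : G ⧸ H)
    refine ⟨t, ?_⟩
    rw [← hFw]
    exact (char_eq_iff_inv_mul_mem_gp χ hker (w t) s).2 (QuotientGroup.eq.1 ht)
  have hsumF : ∑ s ∈ Φ, χ (Additive.ofMul s) =
      ∑ t : Fin 2 × (Π i, ZMod (p i ^ (a i + 1))), ((Φ.filter fun s => χ (Additive.ofMul s) = F t).card : ℂ) * F t := by
    rw [← Finset.sum_fiberwise_of_maps_to (s := Φ) (t := Finset.univ)
      (g := fun s => Classical.choose (hexists s)) (fun s _ => Finset.mem_univ _) (fun s => χ (Additive.ofMul s))]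
    refine Finset.sum_congr rfl fun t _ => ?_
    have hfib : (Φ.filter fun s => Classical.choose (hexists s) = t) = Φ.filter fun s => χ (Additive.ofMul s) = F t := by
      refine Finset.filter_congr fun s _ => ⟨fun hs => ?_, fun hs => ?_⟩
      · rw [← hs]; exact Classical.choose_spec (hexists s)
      · exact hFinj ((Classical.choose_spec (hexists s)).symm.trans hs)
    rw [hfib, Finset.sum_congr rfl fun s hs => (Finset.mem_filter.1 hs).2, Finset.sum_const, nsmul_eq_mul]
  have hsumE : ∑ s ∈ Φ, χ (Additive.ofMul s) =
      ∑ x : (Π i, ZMod (p i ^ (a i + 1))), algebraMap ℚ ℂ (E x) * ∏ i, χ (Additive.ofMul (u i)) ^ (x i).val := by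
    rw [hsumF, Fintype.sum_prod_type, Fin.sum_univ_two, ← Finset.sum_add_distrib]
    refine Finset.sum_congr rfl fun x _ => ?_
    rw [hE, hF]
    dsimp only
    simp only [Fin.val_zero, Fin.val_one, pow_zero, pow_one, one_mul, neg_one_mul, map_sub, map_natCast]
    ring
  -- §B  the criterion in value form
  rw [hsumE, sum_mul_prod_pow_eq_zero_iff_forall_alternatingSum_eq_zero k p a (fun i => χ (Additive.ofMul (u i))) hp hinj hu E]
  have hEval : ∀ x : Π i, ZMod (p i ^ (a i + 1)), E x =
      2 * ((Φ.filter fun s => χ (Additive.ofMul s) = ∏ i, χ (Additive.ofMul (u i)) ^ (x i).val).card : ℚ) -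
        ((Finset.univ.filter fun t : G => χ (Additive.ofMul t) = 1).card : ℚ) := by
    intro x
    rw [hE]
    dsimp only
    have h1 := hneg x
    have h2 := hle x
    rw [h1, Nat.cast_sub h2]
    ring
  -- the value form of the criterion: `Σ_ε (−1)^{|ε|} N(Π μ_i^{(x + ε d)_i}) = 0`
  have hvalue : (∀ x d : Π i, ZMod (p i ^ (a i + 1)), (∀ i, p i • d i = 0) →
        ∑ ε : Fin k → Bool, (∏ i, (if ε i then (-1 : ℚ) else 1)) * E (fun i => if ε i then x i + d i else x i) = 0) ↔
      ∀ x d : Π i, ZMod (p i ^ (a i + 1)), (∀ i, p i • d i = 0) → ∑ ε : Fin k → Bool, (∏ i, (if ε i then (-1 : ℚ) else 1)) *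
        ((Φ.filter fun s => χ (Additive.ofMul s) =
          ∏ i, χ (Additive.ofMul (u i)) ^ ((if ε i then x i + d i else x i)).val).card : ℚ) = 0 := by
    have hrw : ∀ x d : Π i, ZMod (p i ^ (a i + 1)), ∑ ε : Fin k → Bool, (∏ i, (if ε i then (-1 : ℚ) else 1)) *
        E (fun i => if ε i then x i + d i else x i) =
        2 * ∑ ε : Fin k → Bool, (∏ i, (if ε i then (-1 : ℚ) else 1)) *
          ((Φ.filter fun s => χ (Additive.ofMul s) =
            ∏ i, χ (Additive.ofMul (u i)) ^ ((if ε i then x i + d i else x i)).val).card : ℚ) := by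
      intro x d
      simp_rw [hEval]
      rw [Finset.mul_sum]
      have hs := sum_sign_eq_zero_gp hk
      rw [← sub_eq_zero, ← Finset.sum_sub_distrib]
      have : ∑ ε : Fin k → Bool, ((∏ i, (if ε i then (-1 : ℚ) else 1)) *
          (2 * ((Φ.filter fun s => χ (Additive.ofMul s) =
            ∏ i, χ (Additive.ofMul (u i)) ^ ((if ε i then x i + d i else x i)).val).card : ℚ) -
            ((Finset.univ.filter fun t : G => χ (Additive.ofMul t) = 1).card : ℚ)) -
          2 * ((∏ i, (if ε i then (-1 : ℚ) else 1)) *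
            ((Φ.filter fun s => χ (Additive.ofMul s) =
              ∏ i, χ (Additive.ofMul (u i)) ^ ((if ε i then x i + d i else x i)).val).card : ℚ))) =
          -((Finset.univ.filter fun t : G => χ (Additive.ofMul t) = 1).card : ℚ) *
            ∑ ε : Fin k → Bool, (∏ i, (if ε i then (-1 : ℚ) else 1)) := by
        rw [Finset.mul_sum]
        exact Finset.sum_congr rfl fun ε _ => by ring
      rw [this, hs, mul_zero]
    constructor
    · intro hv x d hd
      have := hv x d hd
      rw [hrw] at this
      linarith
    · intro hv x d hd
      rw [hrw, hv x d hd, mul_zero]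
  rw [hvalue]
  -- §C  value counts versus coset counts
  have hN : ∀ g : G, (Φ.filter fun s => g⁻¹ * s ∈ H).card =
      (Φ.filter fun s => χ (Additive.ofMul s) = χ (Additive.ofMul g)).card := fun g => by rw [hcos]
  -- `χ(g · Π_{ε_i} x_i)` in coordinates
  have hcomb : ∀ (e : ℕ) (b d : Π i, ZMod (p i ^ (a i + 1))) (g : G) (x : Fin k → G),
      χ (Additive.ofMul g) = (-1 : ℂ) ^ e * ∏ i, χ (Additive.ofMul (u i)) ^ (b i).val →
      (∀ i, χ (Additive.ofMul (x i)) = χ (Additive.ofMul (u i)) ^ (d i).val) →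
      ∀ ε : Fin k → Bool, χ (Additive.ofMul (g * ∏ i, (if ε i then x i else 1))) =
        (-1 : ℂ) ^ e * ∏ i, χ (Additive.ofMul (u i)) ^ ((if ε i then b i + d i else b i)).val := by
    intro e b d g x hg hx ε
    rw [char_mul_gp, hg, char_prod_gp, mul_assoc, ← Finset.prod_mul_distrib]
    congr 1
    refine Finset.prod_congr rfl fun i _ => ?_
    by_cases hε : ε i
    · rw [if_pos hε, if_pos hε, hx i, pow_val_add_gp (hu i)]
    · rw [if_neg hε, if_neg hε, char_one_gp, mul_one]
  constructor
  · intro hv g x hx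
    -- coordinates of `g` and of the `x_i`
    obtain ⟨⟨e, b⟩, ht⟩ := hexists g
    rw [hF] at ht
    dsimp only at ht
    have hxp : ∀ i, χ (Additive.ofMul (x i)) ^ p i = 1 := fun i => by rw [← char_pow_gp, hker]; exact hx i
    have hd : ∀ i, ∃ n : ℕ, n < p i ^ (a i + 1) ∧ χ (Additive.ofMul (u i)) ^ n = χ (Additive.ofMul (x i)) := fun i => by
      have hxq : χ (Additive.ofMul (x i)) ^ (p i ^ (a i + 1)) = 1 := by
        rw [pow_succ', pow_mul, hxp i, one_pow]
      exact (hu i).eq_pow_of_pow_eq_one hxq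
    choose n hn hnx using hd
    have hx' : ∀ i, χ (Additive.ofMul (x i)) = χ (Additive.ofMul (u i)) ^ (((n i : ℕ) : ZMod (p i ^ (a i + 1)))).val := fun i => by
      rw [ZMod.val_natCast_of_lt (hn i), hnx]
    -- the displacements are admissible: `μ_i^{n_i p_i} = χ(x_i)^{p_i} = 1`, so `p_i^{a_i+1} ∣ p_i n_i`
    have hadm : ∀ i, p i • ((n i : ℕ) : ZMod (p i ^ (a i + 1))) = 0 := fun i => by
      rw [nsmul_eq_mul, ← Nat.cast_mul, ZMod.natCast_eq_zero_iff, ← (hu i).pow_eq_one_iff_dvd, pow_mul', hnx i]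
      exact hxp i
    have key := hv b (fun i => ((n i : ℕ) : ZMod (p i ^ (a i + 1)))) hadm
    have hterm : ∀ ε : Fin k → Bool,
        ((Φ.filter fun s => (g * ∏ i, (if ε i then x i else 1))⁻¹ * s ∈ H).card : ℤ) =
          if (e : ℕ) = 0 then
            ((Φ.filter fun s => χ (Additive.ofMul s) =
              ∏ i, χ (Additive.ofMul (u i)) ^ ((if ε i then b i + ((n i : ℕ) : ZMod (p i ^ (a i + 1))) else b i)).val).card : ℤ)
          else
            ((Finset.univ.filter fun t : G => χ (Additive.ofMul t) = 1).card : ℤ) -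
              ((Φ.filter fun s => χ (Additive.ofMul s) =
                ∏ i, χ (Additive.ofMul (u i)) ^ ((if ε i then b i + ((n i : ℕ) : ZMod (p i ^ (a i + 1))) else b i)).val).card : ℤ) := by
      intro ε
      rw [hN, hcomb e b _ g x ht hx' ε]
      rcases Fin.exists_fin_two.1 ⟨e, rfl⟩ with he | he
      · simp only [he, Fin.val_zero, pow_zero, one_mul, if_true]
      · simp only [he, Fin.val_one, pow_one, neg_one_mul, one_ne_zero, if_false]
        rw [hneg, Nat.cast_sub (hle _)]
    simp_rw [hterm]
    rcases Fin.exists_fin_two.1 ⟨e, rfl⟩ with he | he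
    · simp only [he, Fin.val_zero, if_true]
      have key' := key
      exact_mod_cast key'
    · simp only [he, Fin.val_one, one_ne_zero, if_false, mul_sub, Finset.sum_sub_distrib, ← Finset.sum_mul]
      have hs : ∑ ε : Fin k → Bool, (∏ i, (if ε i then (-1 : ℤ) else 1)) = 0 := by
        exact_mod_cast sum_sign_eq_zero_gp hk
      have key' : ∑ ε : Fin k → Bool, (∏ i, (if ε i then (-1 : ℤ) else 1)) *
          ((Φ.filter fun s => χ (Additive.ofMul s) =
            ∏ i, χ (Additive.ofMul (u i)) ^ ((if ε i then b i + ((n i : ℕ) : ZMod (p i ^ (a i + 1))) else b i)).val).card : ℤ) = 0 := by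
        exact_mod_cast key
      rw [hs, zero_mul, key', sub_zero]
  · intro hcoset b d hd
    have hx : ∀ i, (u i ^ (d i).val) ^ p i ∈ H := fun i => by
      rw [← hker, char_pow_gp, char_pow_gp, ← pow_mul, (hu i).pow_eq_one_iff_dvd]
      have h1 : ((p i * (d i).val : ℕ) : ZMod (p i ^ (a i + 1))) = 0 := by
        rw [Nat.cast_mul, ZMod.natCast_zmod_val, ← nsmul_eq_mul]; exact hd i
      rw [mul_comm]
      exact (ZMod.natCast_eq_zero_iff _ _).1 h1
    have key := hcoset (∏ i, u i ^ (b i).val) (fun i => u i ^ (d i).val) hx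
    have hg : χ (Additive.ofMul (∏ i, u i ^ (b i).val)) = (-1 : ℂ) ^ (0 : ℕ) * ∏ i, χ (Additive.ofMul (u i)) ^ (b i).val := by
      rw [pow_zero, one_mul, hval]
    have hx' : ∀ i, χ (Additive.ofMul (u i ^ (d i).val)) = χ (Additive.ofMul (u i)) ^ (d i).val := fun i => char_pow_gp χ _ _
    have hterm : ∀ ε : Fin k → Bool,
        ((Φ.filter fun s => ((∏ i, u i ^ (b i).val) * ∏ i, (if ε i then u i ^ (d i).val else 1))⁻¹ * s ∈ H).card : ℤ) =
          ((Φ.filter fun s => χ (Additive.ofMul s) =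
            ∏ i, χ (Additive.ofMul (u i)) ^ ((if ε i then b i + d i else b i)).val).card : ℤ) := by
      intro ε
      rw [hN, hcomb 0 b d _ _ hg hx' ε, pow_zero, one_mul]
    simp_rw [hterm] at key
    exact_mod_cast key

omit [DecidableEq G] in
/-- **All characters of an index-`2p₁^{a₁+1}⋯p_k^{a_k+1}` kernel at once**: for `H ∌ ρ` with `G/H` cyclic of order `2Πp_i^{a_i+1}` (pairwise
distinct odd primes, `k ≥ 1`), the `φ(2m) = Π p_i^{a_i}(p_i − 1)` characters with kernel `H` vanish on `S` iff the coset counts of `S` have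
vanishing `k`-th mixed differences along the `p₁⋯p_k`-torsion of `G/H` (so `H` contributes `φ(2m)` to Kubota's defect iff so).
[cite: Kubota1965, §4 Lemma 2]
[cite: Hazama2003CyclicCM, Thm. 4.8] [cite: White1993SporadicCycles, §4, proof of Lemma 3 (p. 131)] [cite: LamLeung2000, Thm. 2.2] -/
theorem forall_sum_char_eq_zero_iff_alternatingSum_of_index_two_mul_primePowers {k : ℕ} {p a : Fin k → ℕ} (hk : 0 < k)
    (hp : ∀ i, (p i).Prime) (hinj : Function.Injective p) (hodd : ∀ i, p i ≠ 2)
    (h : IsCMTypeWith ρ (Φ : Set G)) {H : Subgroup G} (hρH : ρ ∉ H) (hcyc : IsCyclic (G ⧸ H))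
    (hidx : H.index = 2 * ∏ i, p i ^ (a i + 1)) :
    (∀ χ : AddChar (Additive G) ℂ, (∀ g : G, χ (Additive.ofMul g) = 1 ↔ g ∈ H) →
        ∑ s ∈ Φ, χ (Additive.ofMul s) = 0) ↔
      ∀ (g : G) (x : Fin k → G), (∀ i, x i ^ p i ∈ H) →
        ∑ ε : Fin k → Bool, (∏ i, (if ε i then (-1 : ℤ) else 1)) *
          ((Φ.filter fun s => (g * ∏ i, (if ε i then x i else 1))⁻¹ * s ∈ H).card : ℤ) = 0 := by
  have hρ2 := rho_mul_rho_gp h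
  rw [forall_sum_char_eq_zero_iff_exists hρH hρ2 hcyc Φ]
  constructor
  · rintro ⟨ψ, hψ, h0⟩
    exact (sum_char_eq_zero_iff_alternatingSum_of_index_two_mul_primePowers hk hp hinj hodd h ψ hρH hψ hidx hcyc).1 h0
  · intro hsep
    obtain ⟨χ, -, hker⟩ := exists_oddChar_ker hρH hρ2 hcyc
    exact ⟨χ, hker, (sum_char_eq_zero_iff_alternatingSum_of_index_two_mul_primePowers hk hp hinj hodd h χ hρH hker hidx hcyc).2 hsep⟩

end IndexTwicePrimePowers

/-! ## §3 The same criterion for prime families indexed by an arbitrary finite type (subsets of a prime family, as the exponent files need them):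
transport along `Fintype.equivFin` -/

section Fintype

/-- **Index `2·Π_i p_i^{a_i+1}`, family indexed by a finite type `ι`**: the criterion of
`sum_char_eq_zero_iff_alternatingSum_of_index_two_mul_primePowers` for `p a : ι → ℕ` (pairwise distinct odd primes, `ι` nonempty) — the characters
of kernel `H` vanish on `S` iff the `|ι|`-th mixed differences of the coset counts along admissible displacements vanish.  (Reindexing along
`ι ≃ Fin |ι|`; this is the form used with `ι = ↥n.primeFactors` below and with `ι = ↥J` for a set `J` of prime divisors of the exponent.)
[cite: Kubota1965, §4 Lemma 2] [cite: Hazama2003CyclicCM, Lemma 4.6.1 and Thm. 4.8] [cite: LamLeung2000, Thm. 2.2] -/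
theorem sum_char_eq_zero_iff_alternatingSum_of_index_two_mul_primePowers_fintype {ι : Type*} [Fintype ι] [DecidableEq ι]
    {p a : ι → ℕ} (hne : Nonempty ι) (hp : ∀ i, (p i).Prime) (hinj : Function.Injective p) (hodd : ∀ i, p i ≠ 2)
    (h : IsCMTypeWith ρ (Φ : Set G)) (χ : AddChar (Additive G) ℂ) {H : Subgroup G} (hρH : ρ ∉ H)
    (hker : ∀ g : G, χ (Additive.ofMul g) = 1 ↔ g ∈ H) (hidx : H.index = 2 * ∏ i, p i ^ (a i + 1)) (hcyc : IsCyclic (G ⧸ H)) :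
    ∑ s ∈ Φ, χ (Additive.ofMul s) = 0 ↔ ∀ (g : G) (x : ι → G), (∀ i, x i ^ p i ∈ H) →
      ∑ ε : ι → Bool, (∏ i, (if ε i then (-1 : ℤ) else 1)) *
        ((Φ.filter fun s => (g * ∏ i, (if ε i then x i else 1))⁻¹ * s ∈ H).card : ℤ) = 0 := by
  set k : ℕ := Fintype.card ι with hk
  set e : ι ≃ Fin k := Fintype.equivFin ι with he
  have hk0 : 0 < k := Fintype.card_pos_iff.2 hne
  have hidx' : H.index = 2 * ∏ i : Fin k, (p ∘ e.symm) i ^ ((a ∘ e.symm) i + 1) := by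
    rw [hidx, Function.comp_def, Function.comp_def, Equiv.prod_comp e.symm (fun j => p j ^ (a j + 1))]
  rw [sum_char_eq_zero_iff_alternatingSum_of_index_two_mul_primePowers hk0 (fun i => hp (e.symm i))
    (hinj.comp e.symm.injective) (fun i => hodd (e.symm i)) h χ hρH hker hidx' hcyc]
  -- reindex the criterion along `e`
  have hre : ∀ (g : G) (x : ι → G),
      (∑ ε : Fin k → Bool, (∏ i, (if ε i then (-1 : ℤ) else 1)) *
          ((Φ.filter fun s => (g * ∏ i, (if ε i then x (e.symm i) else 1))⁻¹ * s ∈ H).card : ℤ)) =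
        ∑ ε : ι → Bool, (∏ i, (if ε i then (-1 : ℤ) else 1)) *
          ((Φ.filter fun s => (g * ∏ i, (if ε i then x i else 1))⁻¹ * s ∈ H).card : ℤ) := by
    intro g x
    rw [← Equiv.sum_comp (e.arrowCongr (Equiv.refl Bool))]
    refine Finset.sum_congr rfl fun ε _ => ?_
    have hε : ∀ i : Fin k, (e.arrowCongr (Equiv.refl Bool) ε) i = ε (e.symm i) := fun i => rfl
    simp_rw [hε]
    rw [Equiv.prod_comp e.symm (fun j => if ε j then (-1 : ℤ) else 1),
      Equiv.prod_comp e.symm (fun j => if ε j then x j else 1)]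
  constructor
  · intro hfin g x hx
    rw [← hre]
    exact hfin g (fun i => x (e.symm i)) fun i => hx (e.symm i)
  · intro hι g x hx
    have h1 := hι g (fun j => x (e j)) fun j => by simpa only [Equiv.symm_apply_apply] using hx (e j)
    rw [← hre] at h1
    simp only [Equiv.apply_symm_apply] at h1
    exact h1

omit [DecidableEq G] in
/-- **All characters at once, family indexed by a finite type** (index `2·Π_i p_i^{a_i+1}`). [cite: Kubota1965, §4 Lemma 2]
[cite: Hazama2003CyclicCM, Thm. 4.8] [cite: White1993SporadicCycles, §4, proof of Lemma 3 (p. 131)] -/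
theorem forall_sum_char_eq_zero_iff_alternatingSum_of_index_two_mul_primePowers_fintype {ι : Type*} [Fintype ι] [DecidableEq ι]
    {p a : ι → ℕ} (hne : Nonempty ι) (hp : ∀ i, (p i).Prime) (hinj : Function.Injective p) (hodd : ∀ i, p i ≠ 2)
    (h : IsCMTypeWith ρ (Φ : Set G)) {H : Subgroup G} (hρH : ρ ∉ H) (hcyc : IsCyclic (G ⧸ H))
    (hidx : H.index = 2 * ∏ i, p i ^ (a i + 1)) :
    (∀ χ : AddChar (Additive G) ℂ, (∀ g : G, χ (Additive.ofMul g) = 1 ↔ g ∈ H) →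
        ∑ s ∈ Φ, χ (Additive.ofMul s) = 0) ↔
      ∀ (g : G) (x : ι → G), (∀ i, x i ^ p i ∈ H) →
        ∑ ε : ι → Bool, (∏ i, (if ε i then (-1 : ℤ) else 1)) *
          ((Φ.filter fun s => (g * ∏ i, (if ε i then x i else 1))⁻¹ * s ∈ H).card : ℤ) = 0 := by
  have hρ2 := rho_mul_rho_gp h
  rw [forall_sum_char_eq_zero_iff_exists hρH hρ2 hcyc Φ]
  constructor
  · rintro ⟨ψ, hψ, h0⟩
    exact (sum_char_eq_zero_iff_alternatingSum_of_index_two_mul_primePowers_fintype hne hp hinj hodd h ψ hρH hψ hidx hcyc).1 h0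
  · intro hsep
    obtain ⟨χ, -, hker⟩ := exists_oddChar_ker hρH hρ2 hcyc
    exact ⟨χ, hker, (sum_char_eq_zero_iff_alternatingSum_of_index_two_mul_primePowers_fintype hne hp hinj hodd h χ hρH hker hidx hcyc).2 hsep⟩

end Fintype

/-! ## §4 The form indexed by the prime divisors of an arbitrary odd `n > 1` (`[G:H] = 2n`, `G/H` cyclic) — the input of the rank formulas -/

section OddPart

/-- **VANISHING AT A KERNEL OF INDEX `2n`, `n > 1` ODD, CYCLIC QUOTIENT**: `χ(S) = 0` iff for every `g ∈ G` and every family `(x_q)_{q ∣ n prime}`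
with `x_q^q ∈ H` the mixed difference `Σ_{ε ∈ {0,1}^{primes of n}} (−1)^{|ε|} #(S ∩ g·Π_q x_q^{ε_q}·H)` vanishes (the family form of
`sum_char_eq_zero_iff_alternatingSum_of_index_two_mul_primePowers` with `ι = ↥n.primeFactors`, `p_q = q`, `a_q + 1 = v_q(n)`,
`n = Π_q q^{v_q(n)}`). [cite: Kubota1965, §4 Lemma 2] [cite: Hazama2003CyclicCM, Prop. 4.1, Lemma 4.6.1, Thm. 4.8] [cite: LamLeung2000, Thm. 2.2] -/
theorem sum_char_eq_zero_iff_alternatingSum_of_index_two_mul_odd {n : ℕ} (hn1 : n ≠ 1) (hn2 : ¬ 2 ∣ n)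
    (h : IsCMTypeWith ρ (Φ : Set G)) (χ : AddChar (Additive G) ℂ) {H : Subgroup G} (hρH : ρ ∉ H)
    (hker : ∀ g : G, χ (Additive.ofMul g) = 1 ↔ g ∈ H) (hidx : H.index = 2 * n) (hcyc : IsCyclic (G ⧸ H)) :
    ∑ s ∈ Φ, χ (Additive.ofMul s) = 0 ↔ ∀ (g : G) (x : ↥n.primeFactors → G), (∀ q, x q ^ (q : ℕ) ∈ H) →
      ∑ ε : ↥n.primeFactors → Bool, (∏ q, (if ε q then (-1 : ℤ) else 1)) *
        ((Φ.filter fun s => (g * ∏ q, (if ε q then x q else 1))⁻¹ * s ∈ H).card : ℤ) = 0 := by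
  have hn0 : n ≠ 0 := by
    rintro rfl
    exact hn2 (dvd_zero 2)
  have hne : Nonempty ↥n.primeFactors := by
    obtain ⟨q, hq⟩ := Nat.nonempty_primeFactors.2 (lt_of_le_of_ne (Nat.one_le_iff_ne_zero.2 hn0) (Ne.symm hn1))
    exact ⟨⟨q, hq⟩⟩
  have hprod : ∏ q ∈ n.primeFactors, q ^ n.factorization q = n := by
    rw [← Nat.prod_factorization_eq_prod_primeFactors (fun q m => q ^ m)]
    exact Nat.prod_factorization_pow_eq_self hn0
  have hidx' : H.index = 2 * ∏ q : ↥n.primeFactors, (q : ℕ) ^ ((n.factorization q - 1) + 1) := by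
    rw [hidx, Finset.prod_coe_sort n.primeFactors (fun q : ℕ => q ^ ((n.factorization q - 1) + 1))]
    congr 1
    conv_lhs => rw [← hprod]
    refine Finset.prod_congr rfl fun q hq => ?_
    rw [Nat.sub_add_cancel (Nat.one_le_iff_ne_zero.2
      ((Nat.prime_of_mem_primeFactors hq).factorization_pos_of_dvd hn0 (Nat.dvd_of_mem_primeFactors hq)).ne')]
  exact sum_char_eq_zero_iff_alternatingSum_of_index_two_mul_primePowers_fintype hne
    (fun q => Nat.prime_of_mem_primeFactors q.2) Subtype.val_injective
    (fun q h2 => hn2 (h2 ▸ Nat.dvd_of_mem_primeFactors q.2)) h χ hρH hker hidx' hcyc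

omit [DecidableEq G] in
/-- **All characters of an index-`2n` kernel at once** (`n > 1` odd, `G/H` cyclic, `H ∌ ρ`): the `φ(2n)` characters with kernel `H` vanish on `S`
iff the coset counts of `S` have vanishing mixed differences along every family `(x_q)_{q ∣ n prime}`, `x_q^q ∈ H` — so `H` contributes
`φ(n)` to Kubota's defect iff so. [cite: Kubota1965, §4 Lemma 2] [cite: Hazama2003CyclicCM, Thm. 4.8]
[cite: White1993SporadicCycles, §4, proof of Lemma 3 (p. 131)] [cite: LamLeung2000, Thm. 2.2] -/
theorem forall_sum_char_eq_zero_iff_alternatingSum_of_index_two_mul_odd {n : ℕ} (hn1 : n ≠ 1) (hn2 : ¬ 2 ∣ n)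
    (h : IsCMTypeWith ρ (Φ : Set G)) {H : Subgroup G} (hρH : ρ ∉ H) (hcyc : IsCyclic (G ⧸ H)) (hidx : H.index = 2 * n) :
    (∀ χ : AddChar (Additive G) ℂ, (∀ g : G, χ (Additive.ofMul g) = 1 ↔ g ∈ H) →
        ∑ s ∈ Φ, χ (Additive.ofMul s) = 0) ↔
      ∀ (g : G) (x : ↥n.primeFactors → G), (∀ q, x q ^ (q : ℕ) ∈ H) →
        ∑ ε : ↥n.primeFactors → Bool, (∏ q, (if ε q then (-1 : ℤ) else 1)) *
          ((Φ.filter fun s => (g * ∏ q, (if ε q then x q else 1))⁻¹ * s ∈ H).card : ℤ) = 0 := by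
  have hρ2 := rho_mul_rho_gp h
  rw [forall_sum_char_eq_zero_iff_exists hρH hρ2 hcyc Φ]
  constructor
  · rintro ⟨ψ, hψ, h0⟩
    exact (sum_char_eq_zero_iff_alternatingSum_of_index_two_mul_odd hn1 hn2 h ψ hρH hψ hidx hcyc).1 h0
  · intro hsep
    obtain ⟨χ, -, hker⟩ := exists_oddChar_ker hρH hρ2 hcyc
    exact ⟨χ, hker, (sum_char_eq_zero_iff_alternatingSum_of_index_two_mul_odd hn1 hn2 h χ hρH hker hidx hcyc).2 hsep⟩

end OddPart

end AbelianKernels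

end CyclicCMType

end Literature.NumberTheory.ComplexMultiplication

end
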